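import Summits.ResolutionOfSingularities.ResolutionOfSingularities.Theorems.FrobeniusLadderFInjectiveMacaulayficationCMFIDeformsHolds
import Summits.ResolutionOfSingularities.ResolutionOfSingularities.Theorems.FrobeniusLadderFInjectiveMacaulayficationCIChartCore
import Summits.ResolutionOfSingularities.ResolutionOfSingularities.Theorems.FrobeniusLadderFInjectiveMacaulayficationFiLocusOpenOfAffine
import Literature.AlgebraicGeometry.Resolution.CohenMacaulayUnmixed
import Literature.AlgebraicGeometry.Resolution.CohenMacaulaySystemsOfParameters
import Literature.AlgebraicGeometry.Resolution.RegularLocalRingsQuotient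
import Mathlib.RingTheory.KrullDimension.Regular
import Mathlib.RingTheory.Ideal.Quotient.Operations
import HarnessLib

/-!
# R16-RIGID: complete intersections inside a bad Cartier partial boundary never improve `F`
# (crux `FInjectiveMacaulayfication` stmt-ResolutionOfSingularities-15315, chain w45a; res-L1-w45a-idea-1 `ThmDSig.lean` r16.1 §3c
# `fCl_fails_of_ci_in_bad_boundary`, signature VERBATIM; res-L1-w45a-plan-1 R16.4 (3) «stub-2 := R16-RIGID kernel file»; tri-2 SOUND
# 19:33:16Z; seat res-L1-w45a-stub-2)

[OURS · L1 W4.5a] Support file (`--supports stmt-ResolutionOfSingularities-15315 --as helper`); NOT a statement of any manuscript; no named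
fact, no definition, unconditional; AI-written (AI review is weaker than expert review).

THE THEOREM `fCl_fails_of_ci_in_bad_boundary`: let `(𝒪, 𝔪)` be a Noetherian local ring of prime characteristic `p` satisfying the
Cohen–Macaulay clause (`SliceableCentre.CMCl`), `h ∈ 𝔪` with `𝒪/h` FAILING the F-clause (`SliceableCentre.FCl`), and `h, g₁, …, g_c` a
weakly regular sequence in `𝔪`. Then `𝒪/(h, g₁, …, g_c)` fails the F-clause too.

PROOF (contrapositive of iterated Fedder deformation). By induction along the regular sequence, for the successive quotients
`A₀ = 𝒪/h`, `A_{i+1} = A_i/g_{i+1}`: (a) the CM clause DESCENDS to the quotient by a regular element of `𝔪` (`cmCl_quotient`: a maximal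
regular sequence may be started with that element, tree `exists_isRegular_quotSMulTop`, and `dim` drops by one); (b) F-badness PERSISTS: were
`A_i/g` CM + F-clause, Fedder's deformation theorem (tree, PROVED: `CMFIDeformsHolds.sliceableCentre_cmfiDeforms_holds` =
`Deformation.cmfi_of_cmfi_quotient`, Fedder 1983 Thm. 3.4 (1)) would make `A_i` satisfy the F-clause. The successive quotients are
identified with `𝒪/(h, g₁, …, g_i)` by the third isomorphism theorem (`DoubleQuot.quotQuotEquivQuotSup`), along which both clauses transport.
[cite: Fedder1983, Thm. 3.4 (1)] [cite: Matsumura1987, Thm. 17.4 (iii)]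
-/

-- single-problem summit: the doubled namespace component is forced
set_option linter.dupNamespace false

noncomputable section

namespace Summit.ResolutionOfSingularities.ResolutionOfSingularities.Theorems.FInjectiveMacaulayfication.CIInBadBoundary

open IsLocalRing RingTheory.Sequence Literature.AlgebraicGeometry.Resolution
open Summit.ResolutionOfSingularities.ResolutionOfSingularities.Theorems.FInjectiveMacaulayfication
open SliceableCentre

/-! ## §1 The Cohen–Macaulay clause descends to the quotient by a regular element -/

/-- **CM descends modulo a regular element of `𝔪`**: if every system of parameters of the Noetherian local ring `R` is weakly regular and
`y ∈ 𝔪` is a non-zero-divisor, then every system of parameters of `R/y` is weakly regular (a maximal regular sequence of `R` may be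
started with `y`, Matsumura 16.7/17.4; `dim R/y = dim R - 1`). [cite: Matsumura1987, Thm. 17.4 (iii)] -/
theorem cmCl_quotient {R : Type} [CommRing R] [IsNoetherianRing R] [IsLocalRing R] (hCM : CMCl R) {y : R}
    (hym : y ∈ maximalIdeal R) (hy : IsSMulRegular R y) : CMCl (R ⧸ Ideal.span {y}) := by
  obtain ⟨_, hloc⟩ := isLocalRing_quotient_span_singleton hym
  obtain ⟨rs, hrs, hmem, hlen⟩ := exists_isRegular_of_cmClause hCM
  obtain ⟨rs', hlen', hmem', hreg'⟩ := exists_isRegular_quotSMulTop hrs hmem hy hym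
  obtain ⟨hmem₂, hreg₂⟩ := isRegular_quotient_of_isRegular_quotSMulTop hym hreg' hmem'
  have hdim := ringKrullDim_quotient_span_singleton_succ_eq_ringKrullDim hy hym
  obtain ⟨m, hm⟩ := exists_nat_cast_eq_ringKrullDim (R := R ⧸ Ideal.span {y})
  have hlenR : rs.length = m + 1 := by
    rw [hm, ← hlen] at hdim
    exact_mod_cast hdim.symm
  refine cmClause_of_exists_isRegular ⟨rs'.map (Ideal.Quotient.mk (Ideal.span {y})), hreg₂, hmem₂, ?_⟩
  rw [hm, List.length_map, hlen', hlenR, Nat.add_sub_cancel]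

/-- A regular element of a commutative ring (scalar multiplication on itself injective) is a non-zero-divisor. [folklore] -/
theorem mem_nonZeroDivisors_of_isSMulRegular {R : Type} [CommRing R] {y : R} (hy : IsSMulRegular R y) :
    y ∈ nonZeroDivisors R :=
  mem_nonZeroDivisors_iff_left.mpr fun _ hx => hy.right_eq_zero_of_smul hx

/-! ## §2 The core: along a regular sequence, CM descends and F-badness persists -/

/-- **Iterated contrapositive Fedder deformation (list form).** For a Noetherian local ring `A` of prime characteristic `p` with the CM
clause and WITHOUT the F-clause, and a weakly regular sequence `rs ⊆ 𝔪`, the quotient `A/(rs)` has the CM clause and fails the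
F-clause. (Induction on the length, the ring varying.) [cite: Fedder1983, Thm. 3.4 (1)] -/
theorem cmCl_and_not_fCl_quotient_ofList (p : ℕ) [Fact p.Prime] :
    ∀ (n : ℕ) (A : Type) [CommRing A] [IsNoetherianRing A] [IsLocalRing A] [CharP A p] (rs : List A),
      rs.length = n → (∀ r ∈ rs, r ∈ maximalIdeal A) → IsWeaklyRegular A rs → CMCl A → ¬ FCl p A →
        CMCl (A ⧸ Ideal.ofList rs) ∧ ¬ FCl p (A ⧸ Ideal.ofList rs) := by
  intro n
  induction n with
  | zero =>
    intro A _ _ _ _ rs hlen _ _ hCM hF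
    obtain rfl := List.eq_nil_of_length_eq_zero hlen
    let e : (A ⧸ Ideal.ofList ([] : List A)) ≃+* A :=
      (Ideal.quotEquivOfEq (Ideal.ofList_nil)).trans (RingEquiv.quotientBot A)
    exact ⟨FiLocusOpenOfAffine.cmClause_of_ringEquiv e.symm hCM,
      fun hF' => hF (FiLocusOpenOfAffine.fClause_of_ringEquiv p e hF')⟩
  | succ n ih =>
    intro A _ _ _ _ rs hlen hmem hreg hCM hF
    cases rs with
    | nil => simp at hlen
    | cons r rs' =>
      have hr : r ∈ maximalIdeal A := hmem r (by simp)
      have hmem' : ∀ x ∈ rs', x ∈ maximalIdeal A := fun x hx => hmem x (List.mem_cons_of_mem r hx)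
      rw [isWeaklyRegular_cons_iff] at hreg
      obtain ⟨hrreg, hreg'⟩ := hreg
      obtain ⟨hnt, hloc⟩ := isLocalRing_quotient_span_singleton hr
      have hne : Ideal.span {r} ≠ ⊤ := fun htop =>
        (maximalIdeal.isMaximal A).ne_top (top_le_iff.mp (htop ▸ (Ideal.span_singleton_le_iff_mem _).mpr hr))
      haveI : CharP (A ⧸ Ideal.span {r}) p := CIChartCore.charP_quotient_of_ne_top p _ hne
      -- (a) CM descends; (b) F-badness persists (Fedder deformation, contrapositive)
      have hCM' : CMCl (A ⧸ Ideal.span {r}) := cmCl_quotient hCM hr hrreg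
      have hF' : ¬ FCl p (A ⧸ Ideal.span {r}) := fun hF' =>
        hF (CMFIDeformsHolds.sliceableCentre_cmfiDeforms_holds p Fact.out A r hr
          (mem_nonZeroDivisors_of_isSMulRegular hrreg) hCM' hF').2
      -- the tail is a regular sequence on `A/r`
      haveI : Nontrivial (QuotSMulTop r A) := nontrivial_quotSMulTop_of_mem_maximalIdeal A hr
      have hreg'' : IsRegular (QuotSMulTop r A) rs' :=
        IsRegular.of_isWeaklyRegular_of_mem_maximalIdeal (QuotSMulTop r A) hmem' hreg'
      obtain ⟨hmem₂, hreg₂⟩ := isRegular_quotient_of_isRegular_quotSMulTop hr hreg'' hmem'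
      have hlen₂ : (rs'.map (Ideal.Quotient.mk (Ideal.span {r}))).length = n := by
        simpa using hlen
      obtain ⟨hCM₃, hF₃⟩ := ih (A ⧸ Ideal.span {r}) (rs'.map (Ideal.Quotient.mk (Ideal.span {r}))) hlen₂ hmem₂
        hreg₂.toIsWeaklyRegular hCM' hF'
      -- `(A/r)/(rs' mod r) ≃+* A/(r :: rs')` (third isomorphism theorem)
      let e : ((A ⧸ Ideal.span {r}) ⧸ Ideal.ofList (rs'.map (Ideal.Quotient.mk (Ideal.span {r})))) ≃+*
          A ⧸ Ideal.ofList (r :: rs') :=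
        (Ideal.quotEquivOfEq (Ideal.map_ofList (Ideal.Quotient.mk (Ideal.span {r})) rs').symm).trans
          ((DoubleQuot.quotQuotEquivQuotSup (Ideal.span {r}) (Ideal.ofList rs')).trans
            (Ideal.quotEquivOfEq (Ideal.ofList_cons r rs').symm))
      exact ⟨FiLocusOpenOfAffine.cmClause_of_ringEquiv e hCM₃,
        fun h₃ => hF₃ (FiLocusOpenOfAffine.fClause_of_ringEquiv p e.symm h₃)⟩

/-! ## §3 The §3c theorem (ThmDSig r16.1, signature verbatim) -/

section Rigid

variable (p : ℕ) [Fact p.Prime] (𝒪 : Type) [CommRing 𝒪] [IsNoetherianRing 𝒪] [IsLocalRing 𝒪] [CharP 𝒪 p]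

/-- **R16-RIGID (ring core).** CM `𝒪`; `h :: g` a weakly regular sequence in `𝔪`; `𝒪/h` fails the F-clause ⇒ `𝒪/(h, g₁, …, g_c)` fails the
F-clause. (Contrapositive of iterated Fedder deformation: `cmCl_and_not_fCl_quotient_ofList` applied to `A = 𝒪/h` and the images of the
`gᵢ`, then the third isomorphism theorem.) [OURS r16.1, res-L1-w45a-idea-1 ThmDSig §3c] [cite: Fedder1983, Thm. 3.4 (1)] -/
theorem fCl_fails_of_ci_in_bad_boundary (hCM : SliceableCentre.CMCl 𝒪) (h : 𝒪) (hm : h ∈ maximalIdeal 𝒪)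
    (hbad : ¬ SliceableCentre.FCl p (𝒪 ⧸ Ideal.span {h})) {c : ℕ} (g : Fin c → 𝒪) (hg : ∀ i, g i ∈ maximalIdeal 𝒪)
    (hreg : RingTheory.Sequence.IsWeaklyRegular 𝒪 (h :: List.ofFn g)) :
    ¬ SliceableCentre.FCl p (𝒪 ⧸ (Ideal.span {h} ⊔ Ideal.span (Set.range g))) := by
  rw [isWeaklyRegular_cons_iff] at hreg
  obtain ⟨hhreg, hreg'⟩ := hreg
  obtain ⟨hnt, hloc⟩ := isLocalRing_quotient_span_singleton hm
  have hne : Ideal.span {h} ≠ ⊤ := fun htop =>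
    (maximalIdeal.isMaximal 𝒪).ne_top (top_le_iff.mp (htop ▸ (Ideal.span_singleton_le_iff_mem _).mpr hm))
  haveI : CharP (𝒪 ⧸ Ideal.span {h}) p := CIChartCore.charP_quotient_of_ne_top p _ hne
  have hmemg : ∀ x ∈ List.ofFn g, x ∈ maximalIdeal 𝒪 := by
    intro x hx
    obtain ⟨i, rfl⟩ := (List.mem_ofFn' g x).mp hx
    exact hg i
  haveI : Nontrivial (QuotSMulTop h 𝒪) := nontrivial_quotSMulTop_of_mem_maximalIdeal 𝒪 hm
  have hreg'' : IsRegular (QuotSMulTop h 𝒪) (List.ofFn g) :=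
    IsRegular.of_isWeaklyRegular_of_mem_maximalIdeal (QuotSMulTop h 𝒪) hmemg hreg'
  obtain ⟨hmem₂, hreg₂⟩ := isRegular_quotient_of_isRegular_quotSMulTop hm hreg'' hmemg
  obtain ⟨-, hF⟩ := cmCl_and_not_fCl_quotient_ofList p _ (𝒪 ⧸ Ideal.span {h})
    ((List.ofFn g).map (Ideal.Quotient.mk (Ideal.span {h}))) rfl hmem₂ hreg₂.toIsWeaklyRegular
    (cmCl_quotient hCM hm hhreg) hbad
  -- `(𝒪/h)/(g mod h) ≃+* 𝒪/((h) + (g))`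
  have hofList : Ideal.ofList (List.ofFn g) = Ideal.span (Set.range g) := by
    refine congrArg Ideal.span (Set.ext fun x => ?_)
    exact List.mem_ofFn' g x
  let e : ((𝒪 ⧸ Ideal.span {h}) ⧸ Ideal.ofList ((List.ofFn g).map (Ideal.Quotient.mk (Ideal.span {h})))) ≃+*
      𝒪 ⧸ (Ideal.span {h} ⊔ Ideal.span (Set.range g)) :=
    (Ideal.quotEquivOfEq (Ideal.map_ofList (Ideal.Quotient.mk (Ideal.span {h})) (List.ofFn g)).symm).trans
      ((DoubleQuot.quotQuotEquivQuotSup (Ideal.span {h}) (Ideal.ofList (List.ofFn g))).trans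
        (Ideal.quotEquivOfEq (by rw [hofList])))
  exact fun hF' => hF (FiLocusOpenOfAffine.fClause_of_ringEquiv p e.symm hF')

end Rigid

end Summit.ResolutionOfSingularities.ResolutionOfSingularities.Theorems.FInjectiveMacaulayfication.CIInBadBoundary

end
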